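import Summits.AtomisticToContinuum.Crystallization.Theorems.ChartedZeroExcessLayeredLatticeLiouvilleXD
import Summits.AtomisticToContinuum.Crystallization.Theorems.ChartedPlanarOrderPairForceLipschitz

/-!
# Zero-excess layered lattice Liouville — part XZ (lens-2 g60, node «TailKernel»): (I4ˢ) P1 — THE FAR-PAIR KERNEL BOUND

Critic row 1159 STEP 3 / NODE-g60d «TailFluxDesign» (the proof architecture of (I4ˢ) `TailFluxBSP 1 3 (1/16) (1/25)`, UR l.114): the work of the tail force is
a limit of finite double sums of the ANTISYMMETRIC PAIR TERM `pairTerm Ψ x y := pairForce (x − y) − pairForce (Ψ x − Ψ y)` over far pairs (TF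
`tailForce_layeredHom_eq_near_sub_near`), and the whole estimate runs on ONE kernel bound, proved here (all PROVED, 0 sorry):

* XZ.1 `pairTerm`, `pairTerm_swap` (antisymmetry, Newton III), `pairTerm_self`.
* XZ.2 QUASI-ISOMETRY of tear-free registrations of CLEAN configurations: `model_dist_le` — `dist (Ψ x) (Ψ y) ≤ 18·dist x y + 72` from the tree's long bond
  chains (XD `cleanBondPath_real`: sites at distance `≤ r` are joined by `≤ 2r + 8` bonds of length `≤ 28/25`) pushed through the `4 ↦ 9` tear-free bound
  (`model_dist_le_of_chain`); hence `dist x y ≥ dist (Ψ x) (Ψ y)/36` once `dist (Ψ x) (Ψ y) ≥ 144` (`dist_ge_of_model_dist`).  This DISCHARGES the risk named in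
  (I4)'s docstring («bond-connectivity with path length ≲ distance on P-door sets») — it is tree XD.2.
* XZ.3 ★ THE KERNEL BOUND `norm_pairTerm_le`: for `D := dist (Ψ x) (Ψ y) ≥ 144`,
  `‖pairTerm Ψ x y‖ ≤ tailKernelC / D⁸ · ‖(x − Ψ x) − (y − Ψ y)‖`, `tailKernelC = 9·36⁷` —
  case `‖u_x − u_y‖ ≤ D/2` by the tree's Lipschitz modulus of the pair force at floor `D/2` (`pairForce_sub_le`: `15t⁻¹⁴ + 9t⁻⁸`), case `‖u_x − u_y‖ > D/2` by
  XZ.2 and the size bound `norm_pairForce_le_of_le` at floor `D/36` (`2·(t⁻¹³ + t⁻⁷)`, converted with `1 < 2‖u_x − u_y‖/D`).  The exponent `8` is what NODE-g60d's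
  dyadic ledger consumes (margin 3); the constant is `δ`-free.
Next parts (NODE-g60d): YA lattice Poincaré ×2, YB transport through `atomOf`, YC dyadic assembly ⇒ `tailFluxBSP_holds`.
-/

noncomputable section

open scoped BigOperators InnerProductSpace RealInnerProductSpace
open Set Function Metric
open Summit.AtomisticToContinuum.Crystallization.Theorems.ChartedPlanarOrderRigidityDoor (E3)
open Summit.AtomisticToContinuum.Crystallization.Theorems.ChartedPlanarOrderDensityDichotomy (μS IsSep)
open Summit.AtomisticToContinuum.Crystallization.Theorems.ChartedPlanarOrderCleanScaleP (IsCleanP)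
open Summit.AtomisticToContinuum.Crystallization.Theorems.ChartedPlanarOrderProfileSlavingLJ (pairForce)
open Summit.AtomisticToContinuum.Crystallization.Theorems.ChartedPlanarOrderProfileSlavingLJBalance (pairForce_neg)
open Summit.AtomisticToContinuum.Crystallization.Theorems.ChartedPlanarOrderPairForceLipschitz (pairForce_sub_le norm_pairForce_le_of_le)

namespace Summit.AtomisticToContinuum.Crystallization.Theorems.ChartedZeroExcessLayeredLatticeLiouville

variable {S : Set E3} {Ψ : E3 → E3} {x y : E3}

/-! ### XZ.1  The pair term -/

/-- ★ the PAIR TERM of the tail force: the LJ force between the atoms `x, y` minus the LJ force between their model images. [this file, g60] -/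
def pairTerm (Ψ : E3 → E3) (x y : E3) : E3 :=
  pairForce (x - y) - pairForce (Ψ x - Ψ y)

/-- Newton III: the pair term is antisymmetric. [this file, g60] -/
theorem pairTerm_swap (Ψ : E3 → E3) (x y : E3) : pairTerm Ψ y x = -pairTerm Ψ x y := by
  unfold pairTerm
  rw [← neg_sub x y, ← neg_sub (Ψ x) (Ψ y), pairForce_neg, pairForce_neg]
  abel

/-- the diagonal pair term vanishes. [this file, g60] -/
theorem pairTerm_self (Ψ : E3 → E3) (x : E3) : pairTerm Ψ x x = 0 := by
  simp [pairTerm, pairForce]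

/-- the registration displacement identity `x − y = (Ψ x − Ψ y) + ((x − Ψ x) − (y − Ψ y))`. -/
theorem sub_eq_model_add_disp (Ψ : E3 → E3) (x y : E3) : x - y = (Ψ x - Ψ y) + ((x - Ψ x) - (y - Ψ y)) := by
  abel

/-! ### XZ.2  Quasi-isometry of tear-free registrations of clean configurations -/

/-- along a bond chain of `k` bonds a `4 ↦ 9` tear-free map moves the endpoints' images at most `9k` apart. [this file, g60] -/
theorem model_dist_le_of_chain (h49 : ∀ x ∈ S, ∀ p ∈ S, dist p x ≤ 4 → dist (Ψ p) (Ψ x) ≤ 9) {x p : E3} {k : ℕ} {z : ℕ → E3}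
    (hz : IsBondChain S x p k z) : dist (Ψ p) (Ψ x) ≤ 9 * k := by
  obtain ⟨h0, hk, hmem, hbond⟩ := hz
  have key : ∀ i : ℕ, i ≤ k → dist (Ψ (z i)) (Ψ (z 0)) ≤ 9 * i := by
    intro i
    induction i with
    | zero => intro _; simp
    | succ i ih =>
      intro hi
      have hi' : i ≤ k := Nat.le_of_succ_le hi
      have h1 := ih hi'
      have hb : dist (Ψ (z (i + 1))) (Ψ (z i)) ≤ 9 :=
        h49 (z i) (hmem i hi') (z (i + 1)) (hmem (i + 1) hi) ((hbond i (Nat.lt_of_succ_le hi)).trans (by norm_num))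
      calc dist (Ψ (z (i + 1))) (Ψ (z 0)) ≤ dist (Ψ (z (i + 1))) (Ψ (z i)) + dist (Ψ (z i)) (Ψ (z 0)) := dist_triangle _ _ _
        _ ≤ 9 + 9 * i := add_le_add hb h1
        _ = 9 * ((i + 1 : ℕ) : ℝ) := by push_cast; ring
  have h := key k le_rfl
  rwa [hk, h0] at h

/-- ★ **QUASI-ISOMETRY (upper)**: in a `1`-clean configuration a `4 ↦ 9` tear-free map satisfies `dist (Ψ x) (Ψ y) ≤ 18·dist x y + 72` (XD `cleanBondPath_real`).
[this file, g60] -/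
theorem model_dist_le (hS : IsCleanP 1 (μS S)) (h49 : ∀ x ∈ S, ∀ p ∈ S, dist p x ≤ 4 → dist (Ψ p) (Ψ x) ≤ 9) (hx : x ∈ S) (hy : y ∈ S) :
    dist (Ψ x) (Ψ y) ≤ 18 * dist x y + 72 := by
  obtain ⟨k, z, hk, hz⟩ := cleanBondPath_real hS hx hy dist_nonneg le_rfl
  have h := model_dist_le_of_chain h49 hz
  have h9 : (9 : ℝ) * k ≤ 9 * (2 * dist x y + 8) := mul_le_mul_of_nonneg_left hk (by norm_num)
  linarith

/-- ★ **QUASI-ISOMETRY (the form the kernel uses)**: model distance `D ≥ 144` forces source distance `≥ D/36`. [this file, g60] -/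
theorem dist_ge_of_model_dist (hS : IsCleanP 1 (μS S)) (h49 : ∀ x ∈ S, ∀ p ∈ S, dist p x ≤ 4 → dist (Ψ p) (Ψ x) ≤ 9) (hx : x ∈ S) (hy : y ∈ S)
    (hD : 144 ≤ dist (Ψ x) (Ψ y)) : dist (Ψ x) (Ψ y) / 36 ≤ dist x y := by
  have h := model_dist_le hS h49 hx hy
  rw [div_le_iff₀ (by norm_num : (0 : ℝ) < 36)]
  linarith

/-! ### XZ.3  The kernel bound -/

/-- the kernel constant `9·36⁷`. [this file, g60] -/
def tailKernelC : ℝ := 9 * 36 ^ 7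

/-- `tailKernelC_pos` (docstring added by the landing lane; see the module docstring). [formal bookkeeping] -/
theorem tailKernelC_pos : 0 < tailKernelC := by unfold tailKernelC; positivity

/-- powers of a number in `[0, 1]` decrease. -/
theorem pow_le_pow_of_le_one_aux {u : ℝ} (h0 : 0 ≤ u) (h1 : u ≤ 1) {m n : ℕ} (hmn : m ≤ n) : u ^ n ≤ u ^ m :=
  pow_le_pow_of_le_one h0 h1 hmn

/-- ★★ **THE FAR-PAIR KERNEL BOUND**: for atoms `x, y` of a `1`-clean configuration under a `4 ↦ 9` tear-free map with model distance `D := dist (Ψ x) (Ψ y) ≥ 144`,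
`‖pairTerm Ψ x y‖ ≤ tailKernelC / D⁸ · ‖(x − Ψ x) − (y − Ψ y)‖`. [this file, g60] -/
theorem norm_pairTerm_le (hS : IsCleanP 1 (μS S)) (h49 : ∀ x ∈ S, ∀ p ∈ S, dist p x ≤ 4 → dist (Ψ p) (Ψ x) ≤ 9) (hx : x ∈ S) (hy : y ∈ S)
    (hD : 144 ≤ dist (Ψ x) (Ψ y)) :
    ‖pairTerm Ψ x y‖ ≤ tailKernelC / dist (Ψ x) (Ψ y) ^ 8 * ‖(x - Ψ x) - (y - Ψ y)‖ := by
  set D : ℝ := dist (Ψ x) (Ψ y) with hDdef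
  set z : E3 := Ψ x - Ψ y with hzdef
  set h : E3 := (x - Ψ x) - (y - Ψ y) with hhdef
  have hzD : ‖z‖ = D := by rw [hDdef, dist_eq_norm]
  have hxy : x - y = z + h := sub_eq_model_add_disp Ψ x y
  have hD0 : 0 < D := by linarith
  have hD8 : 0 < D ^ 8 := by positivity
  have hh0 : 0 ≤ ‖h‖ := norm_nonneg h
  unfold pairTerm
  rw [hxy]
  by_cases hc : ‖h‖ ≤ D / 2
  · -- case A: the Lipschitz modulus of the pair force at floor `D/2`
    have ht : 0 < D / 2 := by linarith
    have h1 : D / 2 ≤ ‖z + h‖ := by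
      have := norm_sub_le (z + h) h
      rw [add_sub_cancel_right, hzD] at this
      linarith
    have h2 : D / 2 ≤ ‖z‖ := by rw [hzD]; linarith
    have key := pairForce_sub_le ht h1 h2
    rw [add_sub_cancel_left] at key
    have hu : (D / 2)⁻¹ = 2 / D := by rw [inv_div]
    rw [hu] at key
    have hu0 : 0 ≤ 2 / D := by positivity
    have hu1 : 2 / D ≤ 1 := by rw [div_le_one hD0]; linarith
    have h14 : (2 / D) ^ 14 ≤ (2 / D) ^ 8 := pow_le_pow_of_le_one_aux hu0 hu1 (by norm_num)
    have h8 : (2 / D) ^ 8 = 2 ^ 8 / D ^ 8 := div_pow 2 D 8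
    have hmod : 15 * (2 / D) ^ 14 + 9 * (2 / D) ^ 8 ≤ tailKernelC / D ^ 8 := by
      have : 15 * (2 / D) ^ 14 + 9 * (2 / D) ^ 8 ≤ 24 * (2 ^ 8 / D ^ 8) := by rw [← h8]; linarith
      refine this.trans ?_
      rw [tailKernelC, ← mul_div_assoc, div_le_div_iff_of_pos_right hD8]
      norm_num
    exact key.trans (mul_le_mul_of_nonneg_right hmod hh0)
  · -- case B: quasi-isometry and the size bound at floor `D/36`
    push Not at hc
    have hdist : D / 36 ≤ dist x y := dist_ge_of_model_dist hS h49 hx hy hD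
    have ht : 0 < D / 36 := by positivity
    have hA : ‖pairForce (z + h)‖ ≤ (D / 36)⁻¹ ^ 13 + (D / 36)⁻¹ ^ 7 := by
      refine norm_pairForce_le_of_le ht ?_
      rw [← hxy, ← dist_eq_norm]
      exact hdist
    have hB : ‖pairForce z‖ ≤ (D / 36)⁻¹ ^ 13 + (D / 36)⁻¹ ^ 7 := by
      refine norm_pairForce_le_of_le ht ?_
      rw [hzD]; linarith
    have hu : (D / 36)⁻¹ = 36 / D := by rw [inv_div]
    rw [hu] at hA hB
    have hu0 : 0 ≤ 36 / D := by positivity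
    have hu1 : 36 / D ≤ 1 := by rw [div_le_one hD0]; linarith
    have h13 : (36 / D) ^ 13 ≤ (36 / D) ^ 7 := pow_le_pow_of_le_one_aux hu0 hu1 (by norm_num)
    have h7 : (36 / D) ^ 7 = 36 ^ 7 / D ^ 7 := div_pow 36 D 7
    have hsum : ‖pairForce (z + h) - pairForce z‖ ≤ 4 * (36 ^ 7 / D ^ 7) := by
      refine (norm_sub_le _ _).trans ?_
      rw [← h7]; linarith
    -- `1 < 2‖h‖/D`: convert `D⁻⁷` into `D⁻⁸·‖h‖`
    have hD7 : 0 < D ^ 7 := by positivity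
    have hconv : 4 * (36 ^ 7 / D ^ 7) ≤ tailKernelC / D ^ 8 * ‖h‖ := by
      rw [tailKernelC]
      rw [show (9 : ℝ) * 36 ^ 7 / D ^ 8 * ‖h‖ = (9 * 36 ^ 7 * ‖h‖ / D) / D ^ 7 by field_simp]
      rw [show (4 : ℝ) * (36 ^ 7 / D ^ 7) = (4 * 36 ^ 7) / D ^ 7 by ring]
      refine div_le_div_of_nonneg_right ?_ hD7.le
      rw [le_div_iff₀ hD0]
      nlinarith [hc]
    exact hsum.trans hconv

/-- the kernel bound in PRODUCT form (no division), convenient under sums: `D⁸·‖pairTerm‖ ≤ tailKernelC·‖u_x − u_y‖`. [this file, g60] -/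
theorem pow_mul_norm_pairTerm_le (hS : IsCleanP 1 (μS S)) (h49 : ∀ x ∈ S, ∀ p ∈ S, dist p x ≤ 4 → dist (Ψ p) (Ψ x) ≤ 9) (hx : x ∈ S) (hy : y ∈ S)
    (hD : 144 ≤ dist (Ψ x) (Ψ y)) :
    dist (Ψ x) (Ψ y) ^ 8 * ‖pairTerm Ψ x y‖ ≤ tailKernelC * ‖(x - Ψ x) - (y - Ψ y)‖ := by
  have hD8 : 0 < dist (Ψ x) (Ψ y) ^ 8 := by positivity
  have h := norm_pairTerm_le hS h49 hx hy hD
  calc dist (Ψ x) (Ψ y) ^ 8 * ‖pairTerm Ψ x y‖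
      ≤ dist (Ψ x) (Ψ y) ^ 8 * (tailKernelC / dist (Ψ x) (Ψ y) ^ 8 * ‖(x - Ψ x) - (y - Ψ y)‖) := mul_le_mul_of_nonneg_left h hD8.le
    _ = tailKernelC * ‖(x - Ψ x) - (y - Ψ y)‖ := by field_simp

/-- ★ the kernel bound for the WORK of one pair term against a test increment (Cauchy–Schwarz form used by the dyadic assembly):
`|⟪pairTerm Ψ x y, v⟫| ≤ tailKernelC / D⁸ · ‖u_x − u_y‖ · ‖v‖`. [this file, g60] -/
theorem abs_inner_pairTerm_le (hS : IsCleanP 1 (μS S)) (h49 : ∀ x ∈ S, ∀ p ∈ S, dist p x ≤ 4 → dist (Ψ p) (Ψ x) ≤ 9) (hx : x ∈ S) (hy : y ∈ S)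
    (hD : 144 ≤ dist (Ψ x) (Ψ y)) (v : E3) :
    |⟪pairTerm Ψ x y, v⟫_ℝ| ≤ tailKernelC / dist (Ψ x) (Ψ y) ^ 8 * ‖(x - Ψ x) - (y - Ψ y)‖ * ‖v‖ :=
  (abs_real_inner_le_norm _ _).trans (mul_le_mul_of_nonneg_right (norm_pairTerm_le hS h49 hx hy hD) (norm_nonneg v))

end Summit.AtomisticToContinuum.Crystallization.Theorems.ChartedZeroExcessLayeredLatticeLiouville

end
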